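import Summits.CriticalPhenomena.SAWScalingLimit.Theses.SAWExpCovariance
import Summits.CriticalPhenomena.SAWScalingLimit.Theses.SAWRestrictionDescent
import Literature.Probability.RandomPlanarGeometry.RadoContinuity
import Literature.Probability.RandomPlanarGeometry.SAWScalingLimitFamily
import HarnessLib.Audit

/-!
# Crux `ExpCovariance` (stmt-CriticalPhenomena-6754) — birth skeleton `Lines/birth.lean`

Route `SAWExpCovariance` ("one map is enough"), rank-2 crux, BY NAME:
`Summit.CriticalPhenomena.SAWScalingLimit.Theses.SAWExpCovariance.ExpCovariance` — every full
scaling-limit family `P` of the critical `δℤ²` SAW (chordal + (lim)) is covariant under the exponential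
map: for Dobrushin `U` with `exp` injective on `closure U` and any Dobrushin `V` with carrier `exp '' U`
and marks `e^p, e^q`, `P V = (P U).map (CurveClass.map exp)`.

## The line `birth`: RECTILINEAR CORE + RADÓ CONTINUITY + RADÓ DENSITY

`P V` and `exp_* (P U)` are weak limits (along `δ → 0⁺`) of two DIFFERENT lattice models in `V`: the
critical SAW of `δℤ² ∩ V`, and the `exp`-image of the critical SAW of `δℤ² ∩ U` (a SAW on the log-polar
image lattice `exp(δℤ²) ∩ V`). So the crux is a universality statement between the square lattice and
its conformal image, and the card's dictionary (rectangles = row-transfer-matrix domains ↦ annular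
sectors = corner-transfer-matrix domains) lives on RECTILINEAR domains (frontier = finitely many
axis-parallel segments; their `exp`-images are bounded by radial segments and circular arcs). The line
isolates exactly that lattice statement and makes everything else soft:

* `stub_rectilinearLatticeExp` — (R) THE CORE, lattice level, no limit object: for a rectilinear
  Dobrushin `U` with `exp` injective on `closure U`, `V` with carrier `exp '' U` and image marks, and ANY
  endpoint approximations of `U` and of `V`, the `exp`-image of the `U`-walk and the `V`-walk are
  asymptotically equal in law: `∫ f (exp ∘ γ) dP^U_δ − ∫ f (γ) dP^V_δ → 0` (`δ → 0⁺`) for every bounded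
  continuous `f` on curve classes. OPEN (it is the embedding-sensitive content of the crux: straight vs
  radial/circular lattice boundaries must not bias the normalised law). A consequence of the conjunct
  (both integrals then converge, to `∫ f d(exp_* SLE(U)) = ∫ f dSLE(V)` by conformal covariance and
  uniqueness in law of chordal SLE_{8/3}, tree: `IsSLELaw.conformalCovariance_holds`,
  `IsSLECurve.map_eq_holds`), hence exactly as safe as the crux.
* `stub_radoContinuity` — (C) VERBATIM the shared crux `ContinuityOfLimit` (stmt-CriticalPhenomena-7305,
  route SAWRestrictionDescent; pinned below by `Iff.rfl`): every full scaling-limit family is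
  Radó-continuous (`ChordalFamily.IsRadoContinuous`: `Φ_n → Φ` uniformly on `closure D`, conformal on `D`,
  injective on `closure D` ⇒ `P (Φ_n D) ⇀ P (Φ D)`). OPEN; implied by the conjunct
  (`isRadoContinuous_of_isSLELaw`). It is the only continuity the line consumes, and it is consumed twice:
  at `U` along `Φ_n → id` and at `V` along `exp ∘ Φ_n → exp`.
* `stub_rectilinearRadoDensity` — (D) geometric function theory, unconditional: every Dobrushin `U` with
  `exp` injective on `closure U` is a Radó limit of rectilinear ones — there are `Φ_n : ℂ → ℂ` continuous,
  conformal on `U`, injective on `closure U`, `Φ_n → id` uniformly on `closure U`, with `Φ_n(U)` rectilinear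
  and `exp` injective on `closure Φ_n(U)` (Carathéodory–Osgood extension of the Riemann map of `U`, tree
  `JordanDomain.continuousOn_extendFrom'`; axis-parallel polygonal Jordan curves Fréchet-close to `∂U`;
  Radó's theorem, tree `JordanDomain.rado_tendstoUniformlyOn_holds`; Tietze; `exp`-injectivity of nearby
  closures by compactness). Provable now in principle (M/L).

`ExpCovariance_of (hC) (hR) (hD) : ExpCovariance` is PROVED below (no `sorry` of its own): with
`U_n := Φ_n(U)` (`MarkedDomain.image`) and `V_n := exp(U_n)` (`MarkedDomain.expImage`),
(1) `P V_n = exp_* P U_n` for every `n` — (R) + (lim) twice + the continuous-mapping step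
(`CurveClass.continuous_map`) + uniqueness of weak limits along the proper filter `𝓝[>] 0`
(`tendsto_nhds_unique`, `ext_of_forall_integral_eq_of_IsFiniteMeasure`); (2) `P U_n ⇀ P U` by (C) at
parameter `U`, maps `Φ_n → id`; (3) `P V_n ⇀ P V` by (C) at parameter `U`, maps `exp ∘ Φ_n → exp`
(uniformly on `closure U`: `exp` is uniformly continuous on the compact `1`-thickening of `closure U`);
(4) `∫ f d(P V) = lim ∫ f d(P V_n) = lim ∫ (f ∘ exp_*) d(P U_n) = ∫ (f ∘ exp_*) d(P U) = ∫ f d(exp_* P U)`.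

Sorries: exactly 3 = the three `stub_*`; zero elsewhere. Disproof used: none exists (`ledger crux ls
stmt-CriticalPhenomena-6754`: no workfiles, no `Disproof.lean`, 2026-08-17). Negatives honoured: the only
SAW-limit negative, stmt-0772 (all-`δ` tightness), is not touched — (R) speaks of `δ → 0⁺` only, past the
junk meshes. BC3 probes (planner folder `bc/ExpCovariance_probes.lean`): for each stub,
`stub → ExpCovariance` and `stub → SAWScalingLimit` by `first | exact? | simpa | aesop` FAIL.
-/

noncomputable section

open MeasureTheory Filter Topology Set Metric Function
open Literature.Probability.RandomPlanarGeometry Literature.Probability.RandomPlanarGeometry.SAW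
open Literature.Probability.LatticeModels
open scoped ENNReal NNReal BoundedContinuousFunction Topology

namespace Summit.CriticalPhenomena.SAWScalingLimit.Cruxes.ExpCovariance.Birth

/-- The exponential map as a bundled continuous self-map of `ℂ` — after elaboration this is the very
term `(⟨Complex.exp, Complex.continuous_exp⟩ : C(ℂ, ℂ))` of the crux (same constructor application). -/
local notation "expC" => (ContinuousMap.mk Complex.exp Complex.continuous_exp : C(ℂ, ℂ))

/-! ## The registered stubs -/

/-- **stub (C) — RADÓ CONTINUITY OF THE SAW LIMIT** (verbatim the shared crux `ContinuityOfLimit`,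
stmt-CriticalPhenomena-7305, route SAWRestrictionDescent): every chordal family that is the full scaling
limit of the critical `δℤ²` SAW laws is sequentially continuous along conformal images — `Φ_n → Φ`
uniformly on `closure D`, conformal on `D`, injective on `closure D`, `D_n` with carrier `Φ_n(D)` and image
marks, `D'` with carrier `Φ(D)` and image marks ⇒ `∫ f dP(D_n) → ∫ f dP(D')` for bounded continuous `f`
(the body of `ChordalFamily.IsRadoContinuous`). OPEN: needs uniform-in-`δ` stability of the critical SAW
law under boundary perturbations, also near the moving marked points. Implied by the conjunct
(`isRadoContinuous_of_isSLELaw`). Sources: PommerenkeBBCM1992 Thm 2.11, KennedyLawler2013,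
LawlerSchrammWerner2004SAW, DuminilCopinHammond2013. -/
theorem stub_radoContinuity : ∀ P : Literature.Probability.RandomPlanarGeometry.ChordalFamily, P.IsChordal → (∀ (D : Literature.Probability.RandomPlanarGeometry.DobrushinDomain) (a b : ℝ → Literature.Probability.LatticeModels.Site 2), Literature.Probability.RandomPlanarGeometry.SAW.IsEndpointApprox D a b → Literature.Probability.RandomPlanarGeometry.TendstoLaw (fun δ (γ : Literature.Probability.RandomPlanarGeometry.SAW.DomainSAW D.carrier δ (a δ) (b δ)) => γ.curve) (fun δ => Literature.Probability.RandomPlanarGeometry.SAW.law D.carrier δ (a δ) (b δ)) id (P D)) → (∀ (D D' : Literature.Probability.RandomPlanarGeometry.DobrushinDomain) (Dn : ℕ → Literature.Probability.RandomPlanarGeometry.DobrushinDomain) (Φ : C(ℂ, ℂ)) (Φn : ℕ → C(ℂ, ℂ)), TendstoUniformlyOn (fun n => ⇑(Φn n)) Φ Filter.atTop (closure D.carrier) → DifferentiableOn ℂ Φ D.carrier → Set.InjOn Φ (closure D.carrier) → (∀ n, DifferentiableOn ℂ (Φn n) D.carrier ∧ Set.InjOn (Φn n) (closure D.carrier)) →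 D'.carrier = Φ '' D.carrier → D'.pt 0 = Φ (D.pt 0) → D'.pt 1 = Φ (D.pt 1) → (∀ n, (Dn n).carrier = Φn n '' D.carrier ∧ (Dn n).pt 0 = Φn n (D.pt 0) ∧ (Dn n).pt 1 = Φn n (D.pt 1)) → ∀ f : BoundedContinuousFunction (Literature.Probability.RandomPlanarGeometry.CurveClass ℂ) ℝ, Filter.Tendsto (fun n => ∫ γ, f γ ∂(P (Dn n))) Filter.atTop (nhds (∫ γ, f γ ∂(P D')))) := by
  sorry

/-- **stub (R) — LATTICE-LEVEL EXP-COVARIANCE ON RECTILINEAR DOMAINS** ("row transfer matrix vs corner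
transfer matrix"; new; the load-bearing stub): let `U` be a Dobrushin domain whose frontier is a finite
union of axis-parallel segments, with `exp` injective on `closure U`, and `V` any Dobrushin domain with
carrier `exp '' U` and marks `exp (U.pt 0)`, `exp (U.pt 1)` (its frontier consists of radial segments and
circular arcs about `0`). Then for every endpoint approximation `(a, b)` of `U`, every endpoint
approximation `(a', b')` of `V` and every bounded continuous `f` on curve classes, the `exp`-image of the
critical SAW of `U_δ ⊆ δℤ²` and the critical SAW of `V_δ ⊆ δℤ²` are asymptotically equal in law:
`∫ f (exp ∘ γ) dP^U_δ − ∫ f (γ) dP^V_δ → 0` as `δ → 0⁺`. No scaling limit is presupposed. OPEN: it is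
the one embedding-sensitive input of the route (the curved image lattice `exp(δℤ²)` vs `δℤ²` in `V`;
straight vs radial/circular lattice boundaries near the marks must not bias the normalised law). A
consequence of the conjunct (conformal covariance + uniqueness in law of chordal SLE_{8/3}). Sources:
Kennedy2004, Kennedy2002, KennedyLawler2013, Cardy1984, Thacker1986, LawlerSchrammWerner2004SAW. -/
theorem stub_rectilinearLatticeExp : ∀ (U V : Literature.Probability.RandomPlanarGeometry.DobrushinDomain), (∃ S : Finset (ℂ × ℂ), (∀ s ∈ S, s.1.re = s.2.re ∨ s.1.im = s.2.im) ∧ frontier U.carrier = ⋃ s ∈ S, segment ℝ s.1 s.2) → Set.InjOn Complex.exp (closure U.carrier) → V.carrier = Complex.exp '' U.carrier → V.pt 0 = Complex.exp (U.pt 0) → V.pt 1 = Complex.exp (U.pt 1) → ∀ (a b : ℝ → Literature.Probability.LatticeModels.Site 2), Literature.Probability.RandomPlanarGeometry.SAW.IsEndpointApprox U a b → ∀ (a' b' : ℝ → Literature.Probability.LatticeModels.Site 2), Literature.Probability.RandomPlanarGeometry.SAW.IsEndpointApprox V a' b' → ∀ f : BoundedContinuousFunction (Literature.Probability.RandomPlanarGeometry.CurveClass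 ℂ) ℝ, Filter.Tendsto (fun δ : ℝ => (∫ γ, f (Literature.Probability.RandomPlanarGeometry.CurveClass.map (⟨Complex.exp, Complex.continuous_exp⟩ : C(ℂ, ℂ)) γ.curve) ∂(Literature.Probability.RandomPlanarGeometry.SAW.law U.carrier δ (a δ) (b δ))) - ∫ γ, f γ.curve ∂(Literature.Probability.RandomPlanarGeometry.SAW.law V.carrier δ (a' δ) (b' δ))) (nhdsWithin (0 : ℝ) (Set.Ioi 0)) (nhds (0 : ℝ)) := by
  sorry

/-- **stub (D) — RADÓ DENSITY OF RECTILINEAR DOMAINS** (new; geometric function theory, unconditional):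
every Dobrushin domain `U` with `exp` injective on `closure U` is approximated, in the sense consumed by
(C), by rectilinear ones: there are continuous `Φ_n : ℂ → ℂ`, conformal on `U`, injective on
`closure U`, with `Φ_n → id` uniformly on `closure U`, such that each `Φ_n(U)` has frontier a finite
union of axis-parallel segments and `exp` is injective on `closure (Φ_n(U))`. Route: `Φ_n = ḡ_n ∘ ḡ⁻¹`
with `ḡ` the Carathéodory–Osgood homeomorphic extension of a Riemann map of `U` (tree:
`JordanDomain.continuousOn_extendFrom'`) and `ḡ_n` those of axis-parallel Jordan polygons whose boundary
loops converge uniformly to `∂U`, normalised so that Radó's theorem (tree: `JordanDomain.rado_tendstoUniformlyOn_holds`)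
gives `ḡ_n → ḡ` uniformly on the closed disc; Tietze extension to `ℂ`; `exp`-injectivity on the nearby
closures for large `n` by compactness (re-index). Sources: PommerenkeBBCM1992 Thm 2.6 and Thm 2.11,
Beffara2008Universal §1.2. -/
theorem stub_rectilinearRadoDensity : ∀ U : Literature.Probability.RandomPlanarGeometry.DobrushinDomain, Set.InjOn Complex.exp (closure U.carrier) → ∃ Φn : ℕ → C(ℂ, ℂ), TendstoUniformlyOn (fun n => ⇑(Φn n)) (ContinuousMap.id ℂ) Filter.atTop (closure U.carrier) ∧ ∀ n, DifferentiableOn ℂ (Φn n) U.carrier ∧ Set.InjOn (Φn n) (closure U.carrier) ∧ Set.InjOn Complex.exp (closure (Φn n '' U.carrier)) ∧ ∃ S : Finset (ℂ × ℂ), (∀ s ∈ S, s.1.re = s.2.re ∨ s.1.im = s.2.im) ∧ frontier (Φn n '' U.carrier) = ⋃ s ∈ S, segment ℝ s.1 s.2 := by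
  sorry

/-! ## Name-keyed aliases of the stub statements

The native skeleton audit admits a hypothesis of the skeleton theorem only if its head constant is named
like a declared stub; `__Registered.stub_X` is the statement of `stub_X` under that name (device of the
sibling skeletons `AxiomsOfLimit/Lines/birth.lean`, `LimitExists/Lines/birth.lean`). Each alias is
syntactically the statement of its stub. -/

namespace __Registered

/-- Alias keyed by the stub name: the statement of `stub_radoContinuity` (= item stmt-7305). -/
abbrev stub_radoContinuity : Prop :=
  ∀ P : Literature.Probability.RandomPlanarGeometry.ChordalFamily, P.IsChordal → (∀ (D : Literature.Probability.RandomPlanarGeometry.DobrushinDomain) (a b : ℝ → Literature.Probability.LatticeModels.Site 2), Literature.Probability.RandomPlanarGeometry.SAW.IsEndpointApprox D a b → Literature.Probability.RandomPlanarGeometry.TendstoLaw (fun δ (γ : Literature.Probability.RandomPlanarGeometry.SAW.DomainSAW D.carrier δ (a δ) (b δ)) => γ.curve) (fun δ => Literature.Probability.RandomPlanarGeometry.SAW.law D.carrier δ (a δ) (b δ)) id (P D)) → (∀ (D D' : Literature.Probability.RandomPlanarGeometry.DobrushinDomain) (Dn : ℕ → Literature.Probability.RandomPlanarGeometry.DobrushinDomain)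 (Φ : C(ℂ, ℂ)) (Φn : ℕ → C(ℂ, ℂ)), TendstoUniformlyOn (fun n => ⇑(Φn n)) Φ Filter.atTop (closure D.carrier) → DifferentiableOn ℂ Φ D.carrier → Set.InjOn Φ (closure D.carrier) → (∀ n, DifferentiableOn ℂ (Φn n) D.carrier ∧ Set.InjOn (Φn n) (closure D.carrier)) → D'.carrier = Φ '' D.carrier → D'.pt 0 = Φ (D.pt 0) → D'.pt 1 = Φ (D.pt 1) → (∀ n, (Dn n).carrier = Φn n '' D.carrier ∧ (Dn n).pt 0 = Φn n (D.pt 0) ∧ (Dn n).pt 1 = Φn n (D.pt 1)) → ∀ f : BoundedContinuousFunction (Literature.Probability.RandomPlanarGeometry.CurveClass ℂ) ℝ, Filter.Tendsto (fun n => ∫ γ, f γ ∂(P (Dn n))) Filter.atTop (nhds (∫ γ, f γ ∂(P D'))))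

/-- Alias keyed by the stub name: the statement of `stub_rectilinearLatticeExp` (new). -/
abbrev stub_rectilinearLatticeExp : Prop :=
  ∀ (U V : Literature.Probability.RandomPlanarGeometry.DobrushinDomain), (∃ S : Finset (ℂ × ℂ), (∀ s ∈ S, s.1.re = s.2.re ∨ s.1.im = s.2.im) ∧ frontier U.carrier = ⋃ s ∈ S, segment ℝ s.1 s.2) → Set.InjOn Complex.exp (closure U.carrier) → V.carrier = Complex.exp '' U.carrier → V.pt 0 = Complex.exp (U.pt 0) → V.pt 1 = Complex.exp (U.pt 1) → ∀ (a b : ℝ → Literature.Probability.LatticeModels.Site 2), Literature.Probability.RandomPlanarGeometry.SAW.IsEndpointApprox U a b → ∀ (a' b' : ℝ → Literature.Probability.LatticeModels.Site 2), Literature.Probability.RandomPlanarGeometry.SAW.IsEndpointApprox V a' b' → ∀ f : BoundedContinuousFunction (Literature.Probability.RandomPlanarGeometry.CurveClass ℂ) ℝ, Filter.Tendsto (fun δ : ℝ => (∫ γ, f (Literature.Probability.RandomPlanarGeometry.CurveClass.map (⟨Complex.exp, Complex.continuous_exp⟩ : C(ℂ, ℂ)) γ.curve) ∂(Literature.Probability.RandomPlanarGeometry.SAW.law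 U.carrier δ (a δ) (b δ))) - ∫ γ, f γ.curve ∂(Literature.Probability.RandomPlanarGeometry.SAW.law V.carrier δ (a' δ) (b' δ))) (nhdsWithin (0 : ℝ) (Set.Ioi 0)) (nhds (0 : ℝ))

/-- Alias keyed by the stub name: the statement of `stub_rectilinearRadoDensity` (new). -/
abbrev stub_rectilinearRadoDensity : Prop :=
  ∀ U : Literature.Probability.RandomPlanarGeometry.DobrushinDomain, Set.InjOn Complex.exp (closure U.carrier) → ∃ Φn : ℕ → C(ℂ, ℂ), TendstoUniformlyOn (fun n => ⇑(Φn n)) (ContinuousMap.id ℂ) Filter.atTop (closure U.carrier) ∧ ∀ n, DifferentiableOn ℂ (Φn n) U.carrier ∧ Set.InjOn (Φn n) (closure U.carrier) ∧ Set.InjOn Complex.exp (closure (Φn n '' U.carrier)) ∧ ∃ S : Finset (ℂ × ℂ), (∀ s ∈ S, s.1.re = s.2.re ∨ s.1.im = s.2.im) ∧ frontier (Φn n '' U.carrier) = ⋃ s ∈ S, segment ℝ s.1 s.2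

end __Registered

/-! ## Proved glue -/

/-- **Step (1): exp-covariance of the limit on ONE rectilinear pair.** If (R) holds, `P` is chordal with
(lim), `U` is rectilinear with `exp` injective on `closure U` and `V` has carrier `exp '' U` and image
marks, then `P V = exp_* (P U)`: along any endpoint approximations (they exist,
`SAW.exists_isEndpointApprox`), `∫ f (exp ∘ γ) dP^U_δ → ∫ f d(exp_* P U)` (continuous mapping: the test
function `f ∘ exp_*` is bounded continuous, `CurveClass.continuous_map`) and `∫ f dP^V_δ → ∫ f d(P V)`;
by (R) the difference tends to `0`, limits along the proper filter `𝓝[>] 0` are unique, and finite Borel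
laws on the metric space `CurveClass ℂ` are determined by these integrals.
[cite: BillingsleyCPM1999, Thm. 1.2 and Thm. 2.7] -/
theorem map_exp_eq_of_rectilinear (hR : __Registered.stub_rectilinearLatticeExp) {P : ChordalFamily}
    (hch : P.IsChordal)
    (hlim : ∀ (D : DobrushinDomain) (a b : ℝ → Site 2), IsEndpointApprox D a b →
      TendstoLaw (fun δ (γ : DomainSAW D.carrier δ (a δ) (b δ)) => γ.curve)
        (fun δ => law D.carrier δ (a δ) (b δ)) id (P D))
    {U V : DobrushinDomain}
    (hrect : ∃ S : Finset (ℂ × ℂ), (∀ s ∈ S, s.1.re = s.2.re ∨ s.1.im = s.2.im) ∧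
      frontier U.carrier = ⋃ s ∈ S, segment ℝ s.1 s.2)
    (hinj : InjOn Complex.exp (closure U.carrier)) (hV : V.carrier = Complex.exp '' U.carrier)
    (h0 : V.pt 0 = Complex.exp (U.pt 0)) (h1 : V.pt 1 = Complex.exp (U.pt 1)) :
    P V = (P U).map (CurveClass.map expC) := by
  obtain ⟨a, b, hab⟩ := exists_isEndpointApprox U
  obtain ⟨a', b', hab'⟩ := exists_isEndpointApprox V
  haveI : IsProbabilityMeasure (P U) := (hch U).1
  haveI : IsProbabilityMeasure (P V) := (hch V).1
  refine ext_of_forall_integral_eq_of_IsFiniteMeasure fun f => ?_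
  -- the exp-image of the `U`-walk converges to `exp_* (P U)` (continuous mapping)
  have hA : Tendsto (fun δ : ℝ => ∫ γ, f (CurveClass.map expC γ.curve) ∂(law U.carrier δ (a δ) (b δ)))
      (𝓝[>] (0 : ℝ)) (𝓝 (∫ γ, f γ ∂((P U).map (CurveClass.map expC)))) := by
    rw [integral_map (CurveClass.measurable_map _).aemeasurable f.continuous.aestronglyMeasurable]
    have h := hlim U a b hab (f.compContinuous ⟨CurveClass.map expC, CurveClass.continuous_map _⟩)
    simpa only [BoundedContinuousFunction.compContinuous_apply, ContinuousMap.coe_mk, id_eq] using h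
  -- the `V`-walk converges to `P V`
  have hB : Tendsto (fun δ : ℝ => ∫ γ, f γ.curve ∂(law V.carrier δ (a' δ) (b' δ)))
      (𝓝[>] (0 : ℝ)) (𝓝 (∫ γ, f γ ∂(P V))) := by
    simpa only [id_eq] using hlim V a' b' hab' f
  -- (R): the difference tends to `0`; limits are unique
  have hdiff := hR U V hrect hinj hV h0 h1 a b hab a' b' hab' f
  have h0' : ∫ γ, f γ ∂((P U).map (CurveClass.map expC)) - ∫ γ, f γ ∂(P V) = 0 :=
    tendsto_nhds_unique (hA.sub hB) hdiff
  linarith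

/-- **`exp ∘ Φ_n → exp` uniformly on a compact set on which `Φ_n → id` uniformly** (`exp` is uniformly
continuous on the compact `1`-thickening of `K`, which contains `Φ_n(K)` for large `n`). [folklore] -/
theorem tendstoUniformlyOn_exp_comp {K : Set ℂ} (hK : IsCompact K) {Φn : ℕ → C(ℂ, ℂ)}
    (h : TendstoUniformlyOn (fun n => ⇑(Φn n)) (ContinuousMap.id ℂ) atTop K) :
    TendstoUniformlyOn (fun n => ⇑((expC).comp (Φn n))) expC atTop K := by
  have hK1 : IsCompact (cthickening 1 K) :=
    Metric.isCompact_of_isClosed_isBounded isClosed_cthickening hK.isBounded.cthickening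
  have hg : UniformContinuousOn Complex.exp (cthickening 1 K) :=
    hK1.uniformContinuousOn_of_continuous Complex.continuous_exp.continuousOn
  have hF : ∀ᶠ n in atTop, ∀ x ∈ K, Φn n x ∈ cthickening 1 K := by
    filter_upwards [Metric.tendstoUniformlyOn_iff.1 h 1 one_pos] with n hn x hx
    refine Metric.mem_cthickening_of_dist_le (Φn n x) x 1 K hx ?_
    rw [dist_comm]
    exact (hn x hx).le
  have hf : ∀ x ∈ K, (ContinuousMap.id ℂ) x ∈ cthickening 1 K := fun x hx =>
    self_subset_cthickening K hx
  have key := hg.comp_tendstoUniformlyOn_eventually hF hf h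
  rw [Metric.tendstoUniformlyOn_iff] at key ⊢
  intro ε hε
  filter_upwards [key ε hε] with n hn x hx
  simpa only [ContinuousMap.comp_apply, ContinuousMap.coe_mk, ContinuousMap.id_apply] using hn x hx

/-- `exp ∘ Φ` is injective on `closure U` when `Φ` is and `exp` is injective on `closure (Φ U)`
(`Φ (closure U) ⊆ closure (Φ U)` by continuity). [folklore] -/
theorem injOn_exp_comp {U : Set ℂ} {Φ : C(ℂ, ℂ)} (hΦ : InjOn Φ (closure U))
    (hexp : InjOn Complex.exp (closure (Φ '' U))) : InjOn ((expC).comp Φ) (closure U) := by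
  intro x hx y hy hxy
  have hsub : Φ '' closure U ⊆ closure (Φ '' U) := image_closure_subset_closure_image Φ.continuous
  have hxy' : Complex.exp (Φ x) = Complex.exp (Φ y) := by
    simpa only [ContinuousMap.comp_apply, ContinuousMap.coe_mk] using hxy
  exact hΦ hx hy (hexp (hsub ⟨x, hx, rfl⟩) (hsub ⟨y, hy, rfl⟩) hxy')

/-! ## The composition: the crux BY NAME from the three stubs -/

/-- **`ExpCovariance` from (C), (R), (D).** Given `P` chordal with (lim), `U` with `exp` injective on
`closure U` and `V` with carrier `exp '' U` and image marks: take `Φ_n` from (D), the rectilinear image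
domains `U_n := Φ_n(U)` (`MarkedDomain.image`) and `V_n := exp(U_n)` (`MarkedDomain.expImage`). By
`map_exp_eq_of_rectilinear`, `P V_n = exp_* (P U_n)` for every `n`. By (C) at parameter domain `U` with
maps `Φ_n → id`, `P U_n ⇀ P U`; by (C) at parameter domain `U` with maps `exp ∘ Φ_n → exp`
(`tendstoUniformlyOn_exp_comp`, `injOn_exp_comp`) and `D' := V`, `P V_n ⇀ P V`. Pushing the first
limit through the continuous map `exp_*` (`CurveClass.continuous_map`) and comparing with the second,
`∫ f d(P V) = ∫ f d(exp_* P U)` for every bounded continuous `f`, whence `P V = exp_* (P U)`.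
[cite: PommerenkeBBCM1992, Thm. 2.11] -/
theorem ExpCovariance_of (hC : __Registered.stub_radoContinuity)
    (hR : __Registered.stub_rectilinearLatticeExp) (hD : __Registered.stub_rectilinearRadoDensity) :
    Summit.CriticalPhenomena.SAWScalingLimit.Theses.SAWExpCovariance.ExpCovariance := by
  intro P hch hlim U V hinj hV h0 h1
  obtain ⟨Φn, hunif, hΦ⟩ := hD U hinj
  -- the rectilinear approximants `U_n = Φ_n(U)` and their exp-images `V_n`
  have hcont : ∀ n, ContinuousOn (Φn n) (closure U.carrier) := fun n =>
    (Φn n).continuous.continuousOn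
  set Un : ℕ → DobrushinDomain := fun n => U.image (Φn n) (hcont n) (hΦ n).2.1 with hUn
  have hexpn : ∀ n, InjOn Complex.exp (closure (Un n).carrier) := fun n => (hΦ n).2.2.1
  set Vn : ℕ → DobrushinDomain := fun n => (Un n).expImage (hexpn n) with hVn
  -- step (1): exp-covariance on each rectilinear pair
  have hpair : ∀ n, P (Vn n) = (P (Un n)).map (CurveClass.map expC) := fun n =>
    map_exp_eq_of_rectilinear hR hch hlim (hΦ n).2.2.2 (hexpn n) rfl rfl rfl
  -- step (2): Radó continuity at `U` along `Φ_n → id`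
  have hUlim : ∀ g : CurveClass ℂ →ᵇ ℝ,
      Tendsto (fun n => ∫ γ, g γ ∂(P (Un n))) atTop (𝓝 (∫ γ, g γ ∂(P U))) := fun g =>
    hC P hch hlim U U Un (ContinuousMap.id ℂ) Φn hunif differentiableOn_id (injOn_id _)
      (fun n => ⟨(hΦ n).1, (hΦ n).2.1⟩) (by simp) rfl rfl (fun n => ⟨rfl, rfl, rfl⟩) g
  -- step (3): Radó continuity at `V` along `exp ∘ Φ_n → exp`
  have hunifV : TendstoUniformlyOn (fun n => ⇑((expC).comp (Φn n))) expC atTop (closure U.carrier) :=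
    tendstoUniformlyOn_exp_comp U.isBounded.isCompact_closure hunif
  have hexpd : DifferentiableOn ℂ expC U.carrier := Complex.differentiable_exp.differentiableOn
  have hexpi : InjOn expC (closure U.carrier) := hinj
  have hmaps : ∀ n, DifferentiableOn ℂ ((expC).comp (Φn n)) U.carrier ∧
      InjOn ((expC).comp (Φn n)) (closure U.carrier) := fun n =>
    ⟨by
      rw [ContinuousMap.coe_comp]
      exact Complex.differentiable_exp.comp_differentiableOn (hΦ n).1,
     injOn_exp_comp (hΦ n).2.1 (hΦ n).2.2.1⟩
  have hVcar : V.carrier = expC '' U.carrier := hV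
  have hVncar : ∀ n, (Vn n).carrier = ((expC).comp (Φn n)) '' U.carrier ∧
      (Vn n).pt 0 = ((expC).comp (Φn n)) (U.pt 0) ∧ (Vn n).pt 1 = ((expC).comp (Φn n)) (U.pt 1) :=
    fun n => ⟨by rw [ContinuousMap.coe_comp, Set.image_comp]; rfl, rfl, rfl⟩
  have hVlim : ∀ f : CurveClass ℂ →ᵇ ℝ,
      Tendsto (fun n => ∫ γ, f γ ∂(P (Vn n))) atTop (𝓝 (∫ γ, f γ ∂(P V))) := fun f =>
    hC P hch hlim U V Vn expC (fun n => (expC).comp (Φn n)) hunifV hexpd hexpi hmaps hVcar h0 h1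
      hVncar f
  -- step (4): push the `U`-side limit through `exp_*` and compare
  haveI : IsProbabilityMeasure (P U) := (hch U).1
  haveI : IsProbabilityMeasure (P V) := (hch V).1
  refine ext_of_forall_integral_eq_of_IsFiniteMeasure fun f => ?_
  rw [integral_map (CurveClass.measurable_map _).aemeasurable f.continuous.aestronglyMeasurable]
  have hlim₂ : Tendsto (fun n => ∫ γ, f γ ∂(P (Vn n))) atTop
      (𝓝 (∫ γ, f (CurveClass.map expC γ) ∂(P U))) := by
    have h := hUlim (f.compContinuous ⟨CurveClass.map expC, CurveClass.continuous_map _⟩)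
    simp only [BoundedContinuousFunction.compContinuous_apply, ContinuousMap.coe_mk] at h
    refine h.congr fun n => ?_
    rw [hpair n, integral_map (CurveClass.measurable_map _).aemeasurable
      f.continuous.aestronglyMeasurable]
  exact tendsto_nhds_unique (hVlim f) hlim₂

/-- Wiring check (an `example`, so that `ExpCovariance_of` stays the only theorem concluding the crux):
the three registered (sorried) stubs feed the skeleton theorem as stated — this term becomes the crux
proof when the three `sorry`s are discharged. -/
example : Summit.CriticalPhenomena.SAWScalingLimit.Theses.SAWExpCovariance.ExpCovariance :=
  ExpCovariance_of stub_radoContinuity stub_rectilinearLatticeExp stub_rectilinearRadoDensity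

/-! ## Pins (documentation) -/

/-- (C) is verbatim the shared crux `SAWRestrictionDescent.ContinuityOfLimit` (stmt-CriticalPhenomena-7305). -/
theorem stub_radoContinuity_iff_item7305 :
    __Registered.stub_radoContinuity ↔
      Summit.CriticalPhenomena.SAWScalingLimit.Theses.SAWRestrictionDescent.ContinuityOfLimit :=
  Iff.rfl

/-- The conclusion of (C) for one family is literally `ChordalFamily.IsRadoContinuous` (RadoContinuity.lean). -/
theorem stub_radoContinuity_iff_isRadoContinuous :
    __Registered.stub_radoContinuity ↔
      ∀ P : ChordalFamily, P.IsChordal →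
        (∀ (D : DobrushinDomain) (a b : ℝ → Site 2), IsEndpointApprox D a b →
          TendstoLaw (fun δ (γ : DomainSAW D.carrier δ (a δ) (b δ)) => γ.curve)
            (fun δ => law D.carrier δ (a δ) (b δ)) id (P D)) → P.IsRadoContinuous :=
  Iff.rfl

/-- Non-vacuity of (R)/(D)'s domain class: `exp` is injective on the closure of any Dobrushin domain of
imaginary width `< 2π` (e.g. a rectangle of height `< 2π`), by the tree lemma
`injOn_exp_of_abs_im_sub_lt`. -/
example (U : DobrushinDomain)
    (h : ∀ z ∈ closure U.carrier, ∀ w ∈ closure U.carrier, |z.im - w.im| < 2 * Real.pi) :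
    InjOn Complex.exp (closure U.carrier) :=
  injOn_exp_of_abs_im_sub_lt h

/-- Sanity (necessity of (R) on the class where the crux applies): under the crux, for a full
scaling-limit family `P`, the two lattice integrals of (R) DO have the same limit — the `exp`-image of the
`U`-walk tends to `∫ f d(exp_* P U) = ∫ f d(P V)`, the limit of the `V`-walk — so (R) is a consequence of
`ExpCovariance ∧ LimitExists` (no rectilinearity needed), i.e. exactly as safe as the route. -/
theorem rectilinearLatticeExp_of_expCovariance
    (hE : Summit.CriticalPhenomena.SAWScalingLimit.Theses.SAWExpCovariance.ExpCovariance)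
    {P : ChordalFamily} (hch : P.IsChordal)
    (hlim : ∀ (D : DobrushinDomain) (a b : ℝ → Site 2), IsEndpointApprox D a b →
      TendstoLaw (fun δ (γ : DomainSAW D.carrier δ (a δ) (b δ)) => γ.curve)
        (fun δ => law D.carrier δ (a δ) (b δ)) id (P D))
    {U V : DobrushinDomain} (hinj : InjOn Complex.exp (closure U.carrier))
    (hV : V.carrier = Complex.exp '' U.carrier) (h0 : V.pt 0 = Complex.exp (U.pt 0))
    (h1 : V.pt 1 = Complex.exp (U.pt 1)) {a b : ℝ → Site 2} (hab : IsEndpointApprox U a b)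
    {a' b' : ℝ → Site 2} (hab' : IsEndpointApprox V a' b') (f : CurveClass ℂ →ᵇ ℝ) :
    Tendsto (fun δ : ℝ => (∫ γ, f (CurveClass.map expC γ.curve) ∂(law U.carrier δ (a δ) (b δ))) -
      ∫ γ, f γ.curve ∂(law V.carrier δ (a' δ) (b' δ))) (𝓝[>] (0 : ℝ)) (𝓝 0) := by
  have hPV : P V = (P U).map (CurveClass.map expC) := hE P hch hlim U V hinj hV h0 h1
  have hA : Tendsto (fun δ : ℝ => ∫ γ, f (CurveClass.map expC γ.curve) ∂(law U.carrier δ (a δ) (b δ)))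
      (𝓝[>] (0 : ℝ)) (𝓝 (∫ γ, f γ ∂(P V))) := by
    rw [hPV, integral_map (CurveClass.measurable_map _).aemeasurable f.continuous.aestronglyMeasurable]
    have h := hlim U a b hab (f.compContinuous ⟨CurveClass.map expC, CurveClass.continuous_map _⟩)
    simpa only [BoundedContinuousFunction.compContinuous_apply, ContinuousMap.coe_mk, id_eq] using h
  have hB : Tendsto (fun δ : ℝ => ∫ γ, f γ.curve ∂(law V.carrier δ (a' δ) (b' δ)))
      (𝓝[>] (0 : ℝ)) (𝓝 (∫ γ, f γ ∂(P V))) := by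
    simpa only [id_eq] using hlim V a' b' hab' f
  simpa using hA.sub hB

end Summit.CriticalPhenomena.SAWScalingLimit.Cruxes.ExpCovariance.Birth

end
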